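import Mathlib
import HarnessLib
import Literature.Computability.Complexity.CircuitComposition

/-!
# A large family of cheap Boolean functions (`stub_family`)

Route `UniformStream`, crux `UniformStreamLB` (stmt-PneNP-16045), line `birth`: the registered stub
`stub_family` (`--supports stmt-PneNP-16045`) of the calibration-from-below argument (the levels
`c ≤ 1` of the crux's matrix for `s = id` hold unconditionally, by a block-product fooling / counting
argument against one-pass streaming deciders of `MCSP[n ↦ n]`). The counting needs MANY pairwise
distinct Boolean functions on `2k` variables, each of SMALL `B₂`-circuit complexity when read on the
low `2k` of `2k + j` input variables.

**The family.** For a self-map `a : [k] → [k]` let `g_a(x) = ⋁_{i<k} (x_i ∧ x_{k+a(i)})` on `2k`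
variables (`Family.famFun k a`, a left-nested disjunction `Family.orFold` of the `k` conjunctions).

**Theorem (`stub_family`).** For every `k ≥ 1` and `j`: `a ↦ g_a` is injective, and for every `a`
the function `x ↦ g_a(x ∘ Fin.castAdd j)` of `2k + j` variables has `circuitSizeOver B2 ≤ 2k + 2`.
*Proof.* Injectivity: evaluate at the indicator `y` of `{i, k + a(i)}`; `g_a(y) = true` (term `i`),
and `g_{a'}(y) = true` forces a term `i'` with `y_{i'} ∧ y_{k+a'(i')}`; `y_{i'}` with `i' < k` forces
`i' = i`, then `y_{k+a'(i)}` forces `a'(i) = a(i)`. Size: the `k` conjunctions cost `k` gates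
(`CktSize.pi_fin` over `cktSize_and`), the disjunction of `k` values costs `≤ k + 1` gates
(induction on `k`, `cktSize_or`; the empty disjunction is the constant `false`, one gate),
sequential composition adds sizes (`CktSize.comp`), renaming inputs along `Fin.castAdd j` is free
(`CktSize.rewire`), and a single-output straight-line program is a circuit (`CktSize.toCircuit`,
`circuitSizeOver_le_of_computes`). Total `2k + 1 ≤ 2k + 2`. (The hypothesis `1 ≤ k` of the
registered signature is not needed.) [folklore]

Sources: H. Vollmer, *Introduction to Circuit Complexity* (1999), §1.1–1.2 (straight-line
programs, projections, composition); the `CktSize` calculus is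
`Literature/Computability/Complexity/CircuitComposition.lean`.

Not here: the truth-table / streaming side of the calibration (other stubs of the line).
-/

set_option linter.dupNamespace false -- `Summit.PneNP.PneNP.…`: summit = sub-problem (D-0017)

namespace Summit.PneNP.PneNP.Theorems.UniformStreamLB.Birth

open Literature.Computability.Complexity

namespace Family

/-! ## Indexing the `2k` variables -/

/-- The low variable `x_i` (`i < k`) among the `2k` variables `x_0, …, x_{2k-1}`. [folklore] -/
def loVar (k : ℕ) (i : Fin k) : Fin (2 * k) := ⟨i, by omega⟩

/-- The high variable `x_{k+i}` (`i < k`) among the `2k` variables `x_0, …, x_{2k-1}`. [folklore] -/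
def hiVar (k : ℕ) (i : Fin k) : Fin (2 * k) := ⟨k + i, by omega⟩

/-- `i ↦ x_i` is injective. [folklore] -/
theorem loVar_injective (k : ℕ) : Function.Injective (loVar k) := by
  intro i i' h
  simp only [loVar, Fin.mk.injEq] at h
  exact Fin.ext h

/-- `i ↦ x_{k+i}` is injective. [folklore] -/
theorem hiVar_injective (k : ℕ) : Function.Injective (hiVar k) := by
  intro i i' h
  simp only [hiVar, Fin.mk.injEq] at h
  exact Fin.ext (by omega)

/-- A low variable is never a high variable. [folklore] -/
theorem loVar_ne_hiVar (k : ℕ) (i i' : Fin k) : loVar k i ≠ hiVar k i' := by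
  intro h
  simp only [loVar, hiVar, Fin.mk.injEq] at h
  omega

/-! ## The disjunction fold and the family -/

/-- Left-nested disjunction of `k` Boolean values: `orFold 0 y = false`,
`orFold (k+1) y = orFold k (y ∘ castSucc) || y (last k)`. [folklore] -/
def orFold : (k : ℕ) → (Fin k → Bool) → Bool
  | 0, _ => false
  | k + 1, y => (orFold k fun i => y (Fin.castSucc i)) || y (Fin.last k)

/-- `orFold k y` is `true` iff some `y i` is `true`. [folklore] -/
theorem orFold_eq_true_iff : ∀ (k : ℕ) (y : Fin k → Bool), orFold k y = true ↔ ∃ i, y i = true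
  | 0, y => by simp [orFold]
  | k + 1, y => by
    rw [orFold, Bool.or_eq_true, orFold_eq_true_iff k, Fin.exists_fin_succ']

/-- The member `g_a(x) = ⋁_{i<k} (x_i ∧ x_{k+a(i)})` of the fooling family: a Boolean function of
`2k` variables indexed by a self-map `a : [k] → [k]` (as the left-nested `B₂`-expression
`orFold`). [folklore] -/
def famFun (k : ℕ) (a : Fin k → Fin k) (x : Fin (2 * k) → Bool) : Bool :=
  orFold k fun i => x (loVar k i) && x (hiVar k (a i))

/-- `g_a(x) = true` iff `x_i ∧ x_{k+a(i)}` for some `i < k`. [folklore] -/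
theorem famFun_eq_true_iff (k : ℕ) (a : Fin k → Fin k) (x : Fin (2 * k) → Bool) :
    famFun k a x = true ↔ ∃ i, x (loVar k i) = true ∧ x (hiVar k (a i)) = true := by
  simp only [famFun, orFold_eq_true_iff, Bool.and_eq_true]

/-- **Distinctness.** `a ↦ g_a` is injective: evaluating at the indicator of `{i, k + a(i)}`
recovers `a(i)`. [folklore] -/
theorem famFun_injective (k : ℕ) : Function.Injective (famFun k) := by
  intro a a' h
  funext i
  have h1 : famFun k a' (fun p => decide (p = loVar k i ∨ p = hiVar k (a i))) = true := by
    rw [← h, famFun_eq_true_iff]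
    exact ⟨i, by simp, by simp⟩
  rw [famFun_eq_true_iff] at h1
  obtain ⟨i', h2, h3⟩ := h1
  simp only [decide_eq_true_eq] at h2 h3
  have e : i' = i := by
    rcases h2 with h2 | h2
    · exact loVar_injective k h2
    · exact absurd h2 (loVar_ne_hiVar k i' (a i))
  subst e
  rcases h3 with h3 | h3
  · exact absurd h3.symm (loVar_ne_hiVar k _ _)
  · exact (hiVar_injective k h3).symm

/-! ## The circuits -/

/-- The disjunction `orFold k` of `k` given values costs at most `k + 1` gates over `B₂`
(the empty disjunction is the constant `false`, one gate; each further value one `∨₂` gate). [folklore] -/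
theorem cktSize_orFold : ∀ k : ℕ,
    CktSize B2 (fun (y : Fin k → Bool) (_ : Unit) => orFold k y) (k + 1)
  | 0 => (cktSize_const (Fin 0) false).congr fun _ _ => rfl
  | k + 1 => by
    -- stage 1: pass the `k + 1` values through and add the disjunction of the first `k`
    have h1 : CktSize B2 (fun (y : Fin (k + 1) → Bool) =>
        Sum.elim y (fun (_ : Unit) => orFold k fun i => y (Fin.castSucc i))) (0 + (k + 1)) :=
      (CktSize.id B2).pair ((cktSize_orFold k).rewire Fin.castSucc)
    -- stage 2: one more `∨₂` gate with the last value
    have h2 : CktSize B2 (fun (z : Fin (k + 1) ⊕ Unit → Bool) (_ : Unit) =>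
        (z (.inr ()) || z (.inl (Fin.last k)))) 1 := cktSize_or _ _
    exact ((h1.comp h2).of_le (by omega)).congr fun _ _ => rfl

/-- The `k` conjunctions `x_i ∧ x_{k+a(i)}`, `i < k`, bundled as one `k`-output program, cost `k`
gates over `B₂`. [folklore] -/
theorem cktSize_andLayer (k : ℕ) (a : Fin k → Fin k) :
    CktSize B2 (fun (x : Fin (2 * k) → Bool) (i : Fin k) => (x (loVar k i) && x (hiVar k (a i))))
      k := by
  have h : CktSize B2 (fun (x : Fin (2 * k) → Bool) (i : Fin k) =>
      (x (loVar k i) && x (hiVar k (a i)))) (∑ _i : Fin k, 1) :=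
    CktSize.pi_fin fun i => cktSize_and (loVar k i) (hiVar k (a i))
  simpa using h

/-- Each member `g_a` of the family has a `B₂`-program with at most `2k + 1` gates
(`k` conjunctions, then the disjunction fold). [folklore] -/
theorem cktSize_famFun (k : ℕ) (a : Fin k → Fin k) :
    CktSize B2 (fun (x : Fin (2 * k) → Bool) (_ : Unit) => famFun k a x) (2 * k + 1) := by
  have h := (cktSize_andLayer k a).comp (cktSize_orFold k)
  exact (h.of_le (by omega)).congr fun _ _ => rfl

/-- Each member `g_a`, read on the low `2k` of `2k + j` variables, has circuit complexity at most
`2k + 1` over `B₂`. [folklore] -/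
theorem circuitSizeOver_famFun_le (k j : ℕ) (a : Fin k → Fin k) :
    circuitSizeOver B2
        (fun x : Fin (2 * k + j) → Bool => famFun k a fun i => x (Fin.castAdd j i)) ≤
      2 * k + 1 := by
  obtain ⟨C, hB, hsize, heval⟩ := ((cktSize_famFun k a).rewire (Fin.castAdd j)).toCircuit
  exact (circuitSizeOver_le_of_computes C hB heval).trans hsize

end Family

/-- **Stub LOW-G (`stub_family`): a large family of cheap functions.** The `k^k` functions
`g_a(x) = ⋁_{i<k} (x_i ∧ x_{k+a(i)})`, `a : [k] → [k]`, on `2k` variables are pairwise distinct,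
and each — read on the low `2k` of `2k + j` variables — has a `B₂`-circuit with at most `2k + 2`
gates (in fact `2k + 1`; the hypothesis `1 ≤ k` is not used). [folklore] -/
theorem stub_family (k j : ℕ) (_hk : 1 ≤ k) :
    ∃ g : (Fin k → Fin k) → (Fin (2 * k) → Bool) → Bool, Function.Injective g ∧
      ∀ a, circuitSizeOver B2 (fun x : Fin (2 * k + j) → Bool => g a fun i => x (Fin.castAdd j i)) ≤
        2 * k + 2 :=
  ⟨Family.famFun k, Family.famFun_injective k, fun a =>
    (Family.circuitSizeOver_famFun_le k j a).trans (Nat.le_succ _)⟩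

end Summit.PneNP.PneNP.Theorems.UniformStreamLB.Birth
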